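import Summits.FinalStateConjecture.FinalStateConjecture.Theses.SwallowTheDatum
import Literature.Geometry.Lorentzian.ModelData
import Literature.Geometry.Lorentzian.InitialDataPullback
import HarnessLib

/-!
# Crux UniversalWitnessFamily (stmt-FinalStateConjecture-10051) — ideator 2, round 1: first lemmas

Card 1 `throat-settles-too`: the OPEN first sheet of the time-symmetric Einstein–Rosen bridge
shields the WHOLE typed conclusion `P` (∃/∀-MGHD, complete 𝓘⁺, N = 1 decomposition on
`O = J⁺(ιX) ∩ I⁻(charted)`, `HasExhaustiveCharts`), because every clause of `P` lives in Kruskal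
region I = the domain of dependence of the open sheet. Hence
`UniversalWitnessFamily ⟸ ThroatBurial ∧ ThroatShieldedSettles ∧ MGHDExists`
(`universalWitnessFamily_of_throat`, kernel-checked below), with `IsThroatShielded`/`ThroatBurial`
VERBATIM the vocabulary of `Cruxes/WeakCosmicCensorshipMGHD/Lines/throat-is-the-junction.lean`
(crux 9952), so that its four burial stubs serve this crux unchanged.

Card 2 `spinning-floor-moduli`: the d-side of `ThroatBurial` by ONE Chruściel–Delay/Corvino–Schoen
annular gluing whose compensating 10-parameter family is the bag's own light floor pole
(mass μ', centre ξ, Bowen–York P, J with TT support off the heavy throat's flat ball), smooth in the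
gluing radius by the IFT; first checkable lemma = the k = 0 instance `SmoothCorvinoEnding`.
-/

noncomputable section

open scoped Manifold ContDiff Topology
open Bundle Set Filter Function Literature.Geometry.Lorentzian
open Summit.FinalStateConjecture.FinalStateConjecture.Theses.SwallowTheDatum
  (UniversalWitnessFamily MGHDExists SubdataDevelopmentsEmbed)

namespace Summit.FinalStateConjecture.FinalStateConjecture.Cruxes.UniversalWitnessFamily.Sketch2

/-! ## §0 Vocabulary — VERBATIM from `Cruxes/WeakCosmicCensorshipMGHD/Lines/throat-is-the-junction.lean` -/

/-- `{y | R₁ < ‖y‖}` (for `0 < R₁ < M/2`: sheet 1 ∪ throat ∪ a sheet-2 collar of the isotropic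
Schwarzschild slice). -/
def throatRegion (R₁ : ℝ) : TopologicalSpace.Opens E3 :=
  ⟨{y | R₁ < ‖y‖}, isOpen_lt continuous_const continuous_norm⟩

theorem mem_throatRegion {R₁ : ℝ} {y : E3} : y ∈ throatRegion R₁ ↔ R₁ < ‖y‖ := Iff.rfl

theorem zero_notMem_throatRegion {R₁ : ℝ} (hR : 0 < R₁) :
    (0 : E3) ∉ (throatRegion R₁ : Set E3) := by
  simp [throatRegion, hR.le, not_lt.mpr]

/-- VERBATIM 9952: `D` on `X` is **throat-shielded**: mass `M > 0`, junction radius `0 < R₁ < M/2`,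
an open embedding `Φ : {‖y‖ > R₁} → X` with injective differentials, co-compact far zones, and
`Φ^* D = Schwarzschild.conformalData M = ((1 + M/2‖y‖)⁴ δ, 0)` on `{‖y‖ > R₁}`. -/
def IsThroatShielded (X : Type) [TopologicalSpace X] [ChartedSpace E3 X] [IsManifold (𝓡 3) ∞ X]
    (D : InitialDataSet (𝓡 3) X) : Prop :=
  ∃ (M R₁ : ℝ) (hM : 0 < M) (hR : 0 < R₁), R₁ < M / 2 ∧
    ∃ (Φ : throatRegion R₁ → X) (hΦ : ContMDiff 𝓘(ℝ, E3) (𝓡 3) (∞ + 1) Φ)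
      (hΦ' : ∀ u, Function.Injective (mfderiv 𝓘(ℝ, E3) (𝓡 3) Φ u)),
      Topology.IsOpenEmbedding Φ ∧
      (∀ R' : ℝ, IsCompact (Φ '' {y : throatRegion R₁ | R' < ‖(y : E3)‖})ᶜ) ∧
      D.comap Φ hΦ hΦ' =
        Schwarzschild.conformalData (M := M) (throatRegion R₁) hM.le (zero_notMem_throatRegion hR)

/-- VERBATIM 9952: **ThroatBurial** — through every admissible datum passes a jointly smooth,
injective, admissible one-parameter family whose members off `c = 0` are throat-shielded. -/
def ThroatBurial : Prop :=
  ∀ (X : Type) [TopologicalSpace X] [ChartedSpace E3 X] [IsManifold (𝓡 3) ∞ X]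
    [T2Space X] [SecondCountableTopology X] [ConnectedSpace X],
    ∀ d ∈ admissibleVacuumData X, ∃ F : EuclideanSpace ℝ (Fin 1) → InitialDataSet (𝓡 3) X,
      InitialDataSet.IsSmoothDataFamily 1 F ∧ F 0 = d ∧ Function.Injective F ∧
      (∀ c, F c ∈ admissibleVacuumData X) ∧ ∀ c ≠ 0, IsThroatShielded X (F c)

/-! ## §1 Card 1 — the settling certificate for throat-shielded data (NEW: full typed `P`) -/

/-- The `∀`-MGHD part of the summit's conclusion `P`, for a datum `D` on `X` (verbatim the route's
`KerrShieldedSettles` conclusion): complete 𝓘⁺ in the sojourn form AND an `N`-hole final-state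
decomposition in `C²` of the self-determined exterior with sub-extremal holes and exhaustive charts. -/
def SettlesInEveryMGHD (X : Type) [TopologicalSpace X] [ChartedSpace E3 X] [IsManifold (𝓡 3) ∞ X]
    [ConnectedSpace X] (D : InitialDataSet (𝓡 3) X) : Prop :=
  ∀ 𝒟 : VacuumCauchyDevelopment D, 𝒟.IsMaximal →
    Summit.FinalStateConjecture.HasCompleteNullInfinity 𝒟.toCauchyDevelopment ∧
      ∃ (O : Set 𝒟.carrier) (dec : FinalStateDecomposition 𝒟.toSpacetime O 2),
        (∀ i, Kerr.IsSubextremal (dec.mass i) (dec.spin i)) ∧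
          O = Summit.FinalStateConjecture.exteriorOf 𝒟.toCauchyDevelopment dec.charted ∧
            Summit.FinalStateConjecture.HasExhaustiveCharts dec

/-- **Card 1, FIRST LEMMA — `ThroatShieldedSettles`.** An admissible THROAT-shielded datum
(exact `((1 + M/2‖y‖)⁴δ, 0)` on a co-compact chart of `{‖y‖ > R₁}`, `R₁ < M/2`; only the OPEN
sheet `{‖y‖ > M/2}` is used) satisfies the whole `∀`-MGHD conjunct of `P`: in every maximal vacuum
Cauchy development, complete 𝓘⁺ AND an `N = 1`, `a = 0`, motion `(1, 0)` final-state decomposition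
on `O = J⁺(ιX) ∩ I⁻(charted)` with `HasExhaustiveCharts`. Intended proof: the static patch
`𝒦 = (ℝ × {‖y‖ > M/2}, −V²dt² + ψ⁴δ)`, `V = (1 − M/2ρ)/(1 + M/2ρ)`, `ψ = 1 + M/2ρ` (= Kruskal region
I) is a vacuum Cauchy development of the open-sheet sub-datum; by `SubdataDevelopmentsEmbed` it
embeds (`χ`) in every MGHD; `O ⊆ χ(𝒦 ∩ {t ≥ 0})` because a past-directed causal curve from
`χ(region I)` cannot leave `χ(𝒦)` before meeting `ιX` (footprint `[X−|T|, X+|T|] ⊂ (0,∞)`); the hole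
chart is the EXACT isometry Kerr–Schild exterior `{r > 2M}` ≅ region I (deviation ≡ 0 on every near
zone), time-bent beyond `2R(t*)`; flat chart in static time; sojourn ledger `ṙ² ≤ E² ≤ 1`. -/
def ThroatShieldedSettles : Prop :=
  ∀ (X : Type) [TopologicalSpace X] [ChartedSpace E3 X] [IsManifold (𝓡 3) ∞ X]
    [T2Space X] [SecondCountableTopology X] [ConnectedSpace X],
    ∀ D ∈ admissibleVacuumData X, IsThroatShielded X D → SettlesInEveryMGHD X D

/-- The censorship half alone (= 9952's `stub_throatShieldedScri ∧ stub_scriTransfer` output). -/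
def ThroatShieldedScriComplete : Prop :=
  ∀ (X : Type) [TopologicalSpace X] [ChartedSpace E3 X] [IsManifold (𝓡 3) ∞ X]
    [T2Space X] [SecondCountableTopology X] [ConnectedSpace X],
    ∀ D ∈ admissibleVacuumData X, IsThroatShielded X D →
      ∀ 𝒟 : VacuumCauchyDevelopment D, 𝒟.IsMaximal →
        Summit.FinalStateConjecture.HasCompleteNullInfinity 𝒟.toCauchyDevelopment

/-- The decomposition half (THE new content: region I of static Schwarzschild, charted and exhausted,
transported along `χ`). -/
def ThroatShieldedDecomposes : Prop :=
  ∀ (X : Type) [TopologicalSpace X] [ChartedSpace E3 X] [IsManifold (𝓡 3) ∞ X]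
    [T2Space X] [SecondCountableTopology X] [ConnectedSpace X],
    ∀ D ∈ admissibleVacuumData X, IsThroatShielded X D →
      ∀ 𝒟 : VacuumCauchyDevelopment D, 𝒟.IsMaximal →
        ∃ (O : Set 𝒟.carrier) (dec : FinalStateDecomposition 𝒟.toSpacetime O 2),
          (∀ i, Kerr.IsSubextremal (dec.mass i) (dec.spin i)) ∧
            O = Summit.FinalStateConjecture.exteriorOf 𝒟.toCauchyDevelopment dec.charted ∧
              Summit.FinalStateConjecture.HasExhaustiveCharts dec

/-- Glue of the two halves (pure logic). -/
theorem throatShieldedSettles_of (hS : ThroatShieldedScriComplete) (hD : ThroatShieldedDecomposes) :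
    ThroatShieldedSettles := by
  intro X _ _ _ _ _ _ D hD' hsh 𝒟 h𝒟
  exact ⟨hS X D hD' hsh 𝒟 h𝒟, hD X D hD' hsh 𝒟 h𝒟⟩

/-- **Card 1, COMPOSITION (kernel-checked; concludes the crux decl BY NAME).**
`ThroatBurial → ThroatShieldedSettles → MGHDExists → UniversalWitnessFamily`. -/
theorem universalWitnessFamily_of_throat (hB : ThroatBurial) (hS : ThroatShieldedSettles)
    (hM : MGHDExists) : UniversalWitnessFamily := by
  intro X _ _ _ _ _ _ d hd
  obtain ⟨F, hF, h0, hinj, hadm, hsh⟩ := hB X d hd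
  refine ⟨F, hF, h0, hinj, hadm, fun c hc ↦ ⟨hM X (F c) (hadm c), ?_⟩⟩
  intro 𝒟 h𝒟
  exact hS X (F c) (hadm c) (hsh c hc) 𝒟 h𝒟

/-! ## §2 Card 2 — first checkable lemma of the spinning-floor-moduli engine (k = 0 instance) -/

section CardTwo

variable {X : Type} [TopologicalSpace X] [ChartedSpace E3 X] [IsManifold (𝓡 3) ∞ X]

/-- VERBATIM 9952/10052: joint smoothness of the two section maps of a family on a set. -/
def SmoothSectionsOn {P : Type} [TopologicalSpace P] {EP : Type} [NormedAddCommGroup EP]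
    [NormedSpace ℝ EP] {HP : Type} [TopologicalSpace HP] (IP : ModelWithCorners ℝ EP HP)
    [ChartedSpace HP P] (S : P → InitialDataSet (𝓡 3) X) (s : Set (P × X)) : Prop :=
  ContMDiffOn (IP.prod (𝓡 3)) ((𝓡 3).prod 𝓘(ℝ, E3 →L[ℝ] E3 →L[ℝ] ℝ)) ∞
      (fun p : P × X ↦
        TotalSpace.mk' (F := E3 →L[ℝ] E3 →L[ℝ] ℝ)
          (E := fun x : X ↦ TangentSpace (𝓡 3) x →L[ℝ] TangentSpace (𝓡 3) x →L[ℝ] ℝ) p.2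
          ((S p.1).h.inner p.2)) s ∧
    ContMDiffOn (IP.prod (𝓡 3)) ((𝓡 3).prod 𝓘(ℝ, E3 →L[ℝ] E3 →L[ℝ] ℝ)) ∞
      (fun p : P × X ↦
        TotalSpace.mk' (F := E3 →L[ℝ] E3 →L[ℝ] ℝ)
          (E := fun x : X ↦ TangentSpace (𝓡 3) x →L[ℝ] TangentSpace (𝓡 3) x →L[ℝ] ℝ) p.2
          ((S p.1).k p.2)) s

/-- VERBATIM 9952/10052: same sections at `x`. -/
def AgreeAt (D D' : InitialDataSet (𝓡 3) X) (x : X) : Prop :=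
  D.h.inner x = D'.h.inner x ∧ D.k x = D'.k x

/-- In the chart of the end `e`, `D` is EXACTLY isotropic Schwarzschild of mass `m` CENTRED AT `ξ`
beyond chart radius `ρ`: `h = (1 + m/(2‖x − ξ‖))⁴ δ`, `k = 0` (the 4-parameter `(m, ξ)` family that
absorbs the flat cokernel `span{1, xⁱ}` of Corvino's scalar-curvature gluing). -/
def IsExactCentredSchwarzschildBeyond (e : AFEnd X) (D : InitialDataSet (𝓡 3) X) (m : ℝ) (ξ : E3)
    (ρ : ℝ) : Prop :=
  ∀ x : E3, ρ < ‖x‖ →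
    AFEnd.hCoeff e D x = (1 + m / (2 * ‖x - ξ‖)) ^ 4 • (innerSL ℝ : E3 →L[ℝ] E3 →L[ℝ] ℝ) ∧
      AFEnd.kCoeff e D x = 0

/-- **Card 2, FIRST LEMMA (k = 0 instance) — `SmoothCorvinoEnding`.** For every admissible
TIME-SYMMETRIC datum `d` (DR class: only `h − (1+2M/r)δ = o₂(r⁻¹)` is known, higher derivatives
uncontrolled) there are a sole end `e`, a threshold `R⋆`, smooth moduli `m : ℝ → ℝ`, `ξ : ℝ → E3`
and a RADIUS-indexed family `G`, jointly smooth in `(R, x)` on `{R⋆ < R} × X`, such that for every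
`R > R⋆`: `G R` is admissible and time-symmetric, `G R = d` (same sections) off `e.far R`, and
`G R` is EXACTLY isotropic Schwarzschild(`m R`) centred at `ξ R` beyond chart radius `2R`
(Corvino 2000 Thm 1 run at every radius at once by the implicit function theorem in
Chruściel–Delay's weighted SOBOLEV manifold structure, `k = 2 > n/2`, which the DR class feeds). -/
def SmoothCorvinoEnding : Prop :=
  ∀ (X : Type) [TopologicalSpace X] [ChartedSpace E3 X] [IsManifold (𝓡 3) ∞ X]
    [T2Space X] [SecondCountableTopology X] [ConnectedSpace X],
    ∀ d ∈ admissibleVacuumData X, d.IsTimeSymmetric →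
      ∃ (e : AFEnd X) (Rstar : ℝ) (m : ℝ → ℝ) (ξ : ℝ → E3) (G : ℝ → InitialDataSet (𝓡 3) X),
        e.IsSoleEnd ∧ e.R < Rstar ∧ ContDiff ℝ ∞ m ∧ ContDiff ℝ ∞ ξ ∧
        SmoothSectionsOn 𝓘(ℝ, ℝ) G {p : ℝ × X | Rstar < p.1} ∧
        ∀ R : ℝ, Rstar < R →
          G R ∈ admissibleVacuumData X ∧ (G R).IsTimeSymmetric ∧
          (∀ x ∉ e.far R, AgreeAt (G R) d x) ∧
          IsExactCentredSchwarzschildBeyond e (G R) (m R) (ξ R) (2 * R)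

end CardTwo

end Summit.FinalStateConjecture.FinalStateConjecture.Cruxes.UniversalWitnessFamily.Sketch2

end
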